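import Literature.AlgebraicGeometry.HodgeTheory.CoefficientRingHomTwist
import Literature.AlgebraicGeometry.HodgeTheory.AbelianVarietyEndomorphismsHOne
import HarnessLib

/-!
# Crux X1 `CYFormCarrierEight` (route `CYFormCasimir`, stmt-HodgeConjecture-23493), helper file 5:
# coefficient twists `σ_*` (`σ ∈ End(ℂ)`) on the Weil eigenclass spaces `⋀^{2n}W`, `⋀^{2n}W^*`

research route conditional on HC_CM; not a corollary. Nothing here proves HC, HC_CM, the rung H2, X1 or `stub_cyform_exists`;
this is step S4 (Galois equivariance) of `Cruxes/CYFormCarrierEight/STUB-PLAN-stub_cyform_exists.md`: the rationality clause of the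
CY form is proved by Galois descent (`isRationalClass_of_forall_coeffClass_eq`: a class fixed by every coefficient twist `σ_*`,
`σ ∈ Aut(ℂ)`, is rational), which needs to know where `σ_*` sends `E₊ = ⋀^{2n}W` and `E₋ = ⋀^{2n}W^*`.

For a complex abelian variety `A`, `φ : A ⟶ A`, a character `χ`, and a ring endomorphism `σ` of `ℂ`: `σ_*` maps the joint
eigenclasses of character `χ` to those of character `σ ∘ χ` (`σ_*` is `σ`-semilinear and commutes with pull-backs; the tree's
`conjClass_mem_pullbackEigenclasses` is the case `σ = conj`). Since `σ(i√d)² = -d`, `σ(i√d) = ± i√d`, so `σ_*` maps `E₊` to `E₊`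
and `E₋` to `E₋` when `σ(i√d) = i√d`, and exchanges them when `σ(i√d) = -i√d`; in all cases `σ_*` preserves
`W_K ⊗ ℂ = E₊ ⊔ E₋` (which is defined over `ℚ`, Moonen–Zarhin §1).

References: Deligne1982HodgeCycles (I §3, Galois twists), vanGeemen1994HodgeAV (4.9, Lemma 5.2 (6)), MoonenZarhin1998WeilClasses (§1).
-/

-- `Summit.HodgeConjecture.HodgeConjecture.…` is the tree's mandated summit/problem namespace (single-problem summit).
set_option linter.dupNamespace false
noncomputable section

open CategoryTheory
open Literature.AlgebraicTopology.SingularHomology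
open Literature.AlgebraicGeometry.Motives
open Literature.AlgebraicGeometry.HodgeTheory

namespace Summit.HodgeConjecture.HodgeConjecture.Theorems.CYFormCarrier

section CoeffTwist

variable {A : AbelianVariety ℂ} {φ : A ⟶ A} (τ : ℂ →+* ℂ)

/-- **A coefficient twist `σ_*` twists the character of a joint eigenclass**: if `(x·𝟙 + y·φ)^* c = χ(x,y) c` for all
`x, y`, then `(x·𝟙 + y·φ)^* (σ_* c) = σ(χ(x,y)) σ_* c` (`σ_*` is `σ`-semilinear, `coeffClass_ringHom_smul`, and commutes
with pull-backs, `coeffClass_map`). [cite: Deligne1982HodgeCycles, I §3] [cite: vanGeemen1994HodgeAV, 4.9] -/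
theorem coeffClass_mem_pullbackEigenclasses {k : ℕ} {χ : ℕ → ℕ → ℂ} {c : complexBetti A.X k}
    (hc : c ∈ pullbackEigenclasses A φ k χ) :
    coeffClass (R := ℂ) (S := ℂ) τ.toAddMonoidHom k c ∈ pullbackEigenclasses A φ k (fun x y => τ (χ x y)) := by
  rw [mem_pullbackEigenclasses_iff] at hc ⊢
  intro x y
  rw [← coeffClass_ringHom_smul, ← hc x y]
  exact (coeffClass_map _ _ c).symm

/-- A ring endomorphism of `ℂ` maps `i√d` to `± i√d` (it fixes `-d ∈ ℚ` and `(i√d)² = -d`). [folklore] -/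
theorem ringHom_I_mul_sqrt (d : ℕ) :
    τ (Complex.I * (Real.sqrt d : ℂ)) = Complex.I * (Real.sqrt d : ℂ) ∨
      τ (Complex.I * (Real.sqrt d : ℂ)) = -(Complex.I * (Real.sqrt d : ℂ)) := by
  have h : (τ (Complex.I * (Real.sqrt d : ℂ))) ^ 2 = (Complex.I * (Real.sqrt d : ℂ)) ^ 2 := by
    rw [← map_pow, I_mul_sqrt_sq, map_neg, map_natCast]
  exact sq_eq_sq_iff_eq_or_eq_neg.1 h

/-- `σ((x + y i√d)^m) = (x + y σ(i√d))^m`. [folklore] -/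
theorem ringHom_natCast_add_mul_pow (x y d m : ℕ) :
    τ (((x : ℂ) + (y : ℂ) * Complex.I * (Real.sqrt d : ℂ)) ^ m) =
      ((x : ℂ) + (y : ℂ) * τ (Complex.I * (Real.sqrt d : ℂ))) ^ m := by
  rw [map_pow, map_add, map_natCast, mul_assoc, map_mul, map_natCast]

/-- `σ((x - y i√d)^m) = (x - y σ(i√d))^m`. [folklore] -/
theorem ringHom_natCast_sub_mul_pow (x y d m : ℕ) :
    τ (((x : ℂ) - (y : ℂ) * Complex.I * (Real.sqrt d : ℂ)) ^ m) =
      ((x : ℂ) - (y : ℂ) * τ (Complex.I * (Real.sqrt d : ℂ))) ^ m := by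
  rw [map_pow, map_sub, map_natCast, mul_assoc, map_mul, map_natCast]

/-- **`σ_*` preserves `E₊ = ⋀^{2n}W` when `σ(i√d) = i√d`.** [cite: vanGeemen1994HodgeAV, 4.9 and proof of Lemma 5.2 (6)] -/
theorem coeffClass_mem_weilClassesPlus_of_fix {n d : ℕ} (hτ : τ (Complex.I * (Real.sqrt d : ℂ)) = Complex.I * (Real.sqrt d : ℂ))
    {c : complexBetti A.X (2 * n)} (hc : c ∈ weilClassesPlus A φ n d) :
    coeffClass (R := ℂ) (S := ℂ) τ.toAddMonoidHom (2 * n) c ∈ weilClassesPlus A φ n d := by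
  have h := coeffClass_mem_pullbackEigenclasses τ hc
  have e : (fun x y : ℕ => τ (((x : ℂ) + (y : ℂ) * Complex.I * (Real.sqrt d : ℂ)) ^ (2 * n))) =
      fun x y : ℕ => ((x : ℂ) + (y : ℂ) * Complex.I * (Real.sqrt d : ℂ)) ^ (2 * n) := by
    funext x y; rw [ringHom_natCast_add_mul_pow, hτ, mul_assoc]
  rw [e] at h
  exact h

/-- **`σ_*` preserves `E₋ = ⋀^{2n}W^*` when `σ(i√d) = i√d`.** [cite: vanGeemen1994HodgeAV, 4.9 and proof of Lemma 5.2 (6)] -/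
theorem coeffClass_mem_weilClassesMinus_of_fix {n d : ℕ} (hτ : τ (Complex.I * (Real.sqrt d : ℂ)) = Complex.I * (Real.sqrt d : ℂ))
    {c : complexBetti A.X (2 * n)} (hc : c ∈ weilClassesMinus A φ n d) :
    coeffClass (R := ℂ) (S := ℂ) τ.toAddMonoidHom (2 * n) c ∈ weilClassesMinus A φ n d := by
  have h := coeffClass_mem_pullbackEigenclasses τ hc
  have e : (fun x y : ℕ => τ (((x : ℂ) - (y : ℂ) * Complex.I * (Real.sqrt d : ℂ)) ^ (2 * n))) =
      fun x y : ℕ => ((x : ℂ) - (y : ℂ) * Complex.I * (Real.sqrt d : ℂ)) ^ (2 * n) := by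
    funext x y; rw [ringHom_natCast_sub_mul_pow, hτ, mul_assoc]
  rw [e] at h
  exact h

/-- **`σ_*` maps `E₊` into `E₋` when `σ(i√d) = -i√d`** (e.g. `σ = conj`). [cite: vanGeemen1994HodgeAV, proof of Lemma 5.2 (6)] -/
theorem coeffClass_mem_weilClassesMinus_of_swap {n d : ℕ}
    (hτ : τ (Complex.I * (Real.sqrt d : ℂ)) = -(Complex.I * (Real.sqrt d : ℂ)))
    {c : complexBetti A.X (2 * n)} (hc : c ∈ weilClassesPlus A φ n d) :
    coeffClass (R := ℂ) (S := ℂ) τ.toAddMonoidHom (2 * n) c ∈ weilClassesMinus A φ n d := by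
  have h := coeffClass_mem_pullbackEigenclasses τ hc
  have e : (fun x y : ℕ => τ (((x : ℂ) + (y : ℂ) * Complex.I * (Real.sqrt d : ℂ)) ^ (2 * n))) =
      fun x y : ℕ => ((x : ℂ) - (y : ℂ) * Complex.I * (Real.sqrt d : ℂ)) ^ (2 * n) := by
    funext x y; rw [ringHom_natCast_add_mul_pow, hτ, mul_neg, mul_assoc, sub_eq_add_neg]
  rw [e] at h
  exact h

/-- **`σ_*` maps `E₋` into `E₊` when `σ(i√d) = -i√d`.** [cite: vanGeemen1994HodgeAV, proof of Lemma 5.2 (6)] -/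
theorem coeffClass_mem_weilClassesPlus_of_swap {n d : ℕ}
    (hτ : τ (Complex.I * (Real.sqrt d : ℂ)) = -(Complex.I * (Real.sqrt d : ℂ)))
    {c : complexBetti A.X (2 * n)} (hc : c ∈ weilClassesMinus A φ n d) :
    coeffClass (R := ℂ) (S := ℂ) τ.toAddMonoidHom (2 * n) c ∈ weilClassesPlus A φ n d := by
  have h := coeffClass_mem_pullbackEigenclasses τ hc
  have e : (fun x y : ℕ => τ (((x : ℂ) - (y : ℂ) * Complex.I * (Real.sqrt d : ℂ)) ^ (2 * n))) =
      fun x y : ℕ => ((x : ℂ) + (y : ℂ) * Complex.I * (Real.sqrt d : ℂ)) ^ (2 * n) := by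
    funext x y; rw [ringHom_natCast_sub_mul_pow, hτ, mul_neg, mul_assoc, sub_neg_eq_add]
  rw [e] at h
  exact h

/-- **The Weil space `W_K ⊗ ℂ = E₊ ⊔ E₋` is stable under every coefficient twist `σ_*`** (it is defined over `ℚ`).
[cite: MoonenZarhin1998WeilClasses, §1] [cite: Deligne1982HodgeCycles, I §3] -/
theorem coeffClass_mem_weilClassesOf {n d : ℕ} {c : complexBetti A.X (2 * n)} (hc : c ∈ weilClassesOf A φ n d) :
    coeffClass (R := ℂ) (S := ℂ) τ.toAddMonoidHom (2 * n) c ∈ weilClassesOf A φ n d := by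
  obtain ⟨c₁, h₁, c₂, h₂, rfl⟩ := Submodule.mem_sup.mp hc
  rw [map_add]
  rcases ringHom_I_mul_sqrt τ d with hτ | hτ
  · exact Submodule.add_mem _ (Submodule.mem_sup_left (coeffClass_mem_weilClassesPlus_of_fix τ hτ h₁))
      (Submodule.mem_sup_right (coeffClass_mem_weilClassesMinus_of_fix τ hτ h₂))
  · exact Submodule.add_mem _ (Submodule.mem_sup_right (coeffClass_mem_weilClassesMinus_of_swap τ hτ h₁))
      (Submodule.mem_sup_left (coeffClass_mem_weilClassesPlus_of_swap τ hτ h₂))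

end CoeffTwist

end Summit.HodgeConjecture.HodgeConjecture.Theorems.CYFormCarrier

end
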